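import Literature.Topology.FourManifolds.EntranceSheetLaw
import Literature.Topology.FourManifolds.SphereConeJacobian
import Literature.Topology.FourManifolds.CoupleConjugacy
import Literature.Topology.FourManifolds.EntranceDirectionCharts

/-!
# The entrance transition maps of a couple and a sphere diffeomorphism

Topic `Literature/Topology/FourManifolds` (support of `stmt-SmoothPoincare4-15190`, structure
conjugacy; step from the `3`-dimensional orientation law `EntranceSheetLaw.lean` to the
`2`-dimensional transition maps of the unit entrance charts).  Everything here is **proved**.

For couple saddle data `Q` (dimension `3`, boxes of index `1`, equal bottom and saddle values),
a saddle `s` of `A` and a diffeomorphism `φ` of `S²` mapping the unit core directions of `s` to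
those of `σ s` (`hφ0`):

* `coneU Q φ s b y = rad • φ (unit (entDir_A s b y))` — the `B`-direction assigned by `φ` to the
  entrance point `entW_A s b y`;
* `tPlanar Q φ s b = entBack_B (σ s) ∘ coneU …` — **the planar transition map** of the entrance
  charts (`tPlanar 0 = 0`, smooth at `0`);
* `piMap Q φ s = coord_B ∘ coneParam_B ∘ sphereCone φ ∘ transition_A s` — **the spatial
  transition map** between the two Milnor charts through the cones;
* `piMap_entPoint` — `piMap (entPoint ε b y) = entPoint ε b (tPlanar y)` near `y = 0`;
* `milnorQuadratic_piMap` — `Q₁ ∘ piMap = Q₁` near the entrance vectors;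
* `fderiv_piMap_comp_consZeroL`, `fderiv_piMap_apply_zero` — the differential of `piMap` at the
  entrance vector preserves the hyperplane `{u₀ = 0}`, acting there as `d(tPlanar)₀`, and preserves
  the coordinate `u₀`.

## References

* J. Milnor, *Lectures on the h-cobordism theorem* (1965), Def. 3.9, proof of Thm. 3.12/3.13
  (PDF pp. 16–19). [MilnorHCobordism1965]
-/

open scoped Manifold ContDiff Topology
open Set Function Filter Metric Module

noncomputable section

namespace Literature.Topology.FourManifolds

open Cobordism FourManifolds.Flow TracePolar

universe u

/-! ### The entrance sheet through the inverse entrance chart -/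

namespace BasinPair.SaddleData

variable {W : Type u} [TopologicalSpace W] [T2Space W] [SecondCountableTopology W]
  [CompactSpace W] [ChartedSpace (EuclideanHalfSpace (2 + 1)) W] [IsManifold (𝓡∂ (2 + 1)) ∞ W]
  {g : W → ℝ} {ξA ξB : Π x : W, TangentSpace (𝓡∂ (2 + 1)) x} {P : BasinPair g ξA ξB} (Q : P.SaddleData)

/-- Local notation for the model plane and space. -/
local notation "E2" => EuclideanSpace ℝ (Fin 2)
local notation "E3" => EuclideanSpace ℝ (Fin 3)

variable {s : SaddlePt 2 g} (hk : (Q.DA s).k = 1) {b : Bool}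
include hk

/-- **On the inverse-chart domain, `entW s b (entBack u)` is the entrance point of the ray of `u`,
and `‖entBack u‖² < δ`.** [cite: MilnorHCobordism1965, proof of Thm. 3.13 (PDF pp. 18–19)] -/
theorem entW_entBack {δ : ℝ} (hδ : δ ≤ Q.ε ^ 2) {u : E3} (hu : u ∈ Q.entDom s b δ) :
    Q.entW s b (Q.entBack s u) = Q.entOf u ∧ ‖Q.entBack s u‖ ^ 2 < δ := by
  obtain ⟨-, -, hhit, hU, hsign⟩ := hu
  have heℓ : g (Q.entOf u) = Q.c - Q.ε ^ 2 := P.A.apply_levelProj hhit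
  obtain ⟨b', y', hy', he⟩ := Q.exists_eq_entW_of_mem_Uent hk hU heℓ
  have hy'ε : ‖y'‖ ^ 2 < Q.ε ^ 2 := hy'.trans_le hδ
  have hcoord : (Q.DA s).coord (Q.entOf u) = entPoint Q.ε b' y' := by
    rw [he]; exact (entW_mem_chartBall (Q := Q) (s := s) (b := b') hy'ε).2
  have hb : b' = b := by
    refine eq_of_boolSign_mul_pos (boolSign_mul_entPoint_zero_pos Q.ε_pos b' y') ?_
    rw [hcoord] at hsign; exact hsign
  subst hb
  have hback : Q.entBack s u = y' := by rw [entBack_def, hcoord, yv_entPoint]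
  rw [hback]
  exact ⟨he.symm, hy'⟩

end BasinPair.SaddleData

namespace BasinCouple.SaddleData

attribute [local instance] fact_finrank_euclideanSpace_succ

variable {W : Type u} [TopologicalSpace W] [T2Space W] [SecondCountableTopology W]
  [CompactSpace W] [ChartedSpace (EuclideanHalfSpace (2 + 1)) W] [IsManifold (𝓡∂ (2 + 1)) ∞ W]
  {gA gB : W → ℝ} {ξA ξB : Π x : W, TangentSpace (𝓡∂ (2 + 1)) x} {C : BasinCouple gA gB ξA ξB}
  (Q : C.SaddleData)

/-- Local notation for the model plane and space. -/
local notation "E2" => EuclideanSpace ℝ (Fin 2)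
local notation "E3" => EuclideanSpace ℝ (Fin 3)

/-! ### The maps -/

/-- **The `B`-direction assigned by `φ` to the entrance point `entW_A s b y`** (norm `rad`). [folklore] -/
def coneU (φ : Metric.sphere (0 : E3) 1 ≃ₘ⟮𝓡 2, 𝓡 2⟯ Metric.sphere (0 : E3) 1) (s : SaddlePt 2 gA) (b : Bool) (y : E2) : E3 :=
  C.A.rad • (φ (unitVec (Q.QA.entDir s b y)) : E3)

/-- **The planar transition map** of the entrance charts of `s` and `σ s` through `φ`. [cite: MilnorHCobordism1965, proof of Thm. 3.13] -/
def tPlanar (φ : Metric.sphere (0 : E3) 1 ≃ₘ⟮𝓡 2, 𝓡 2⟯ Metric.sphere (0 : E3) 1) (s : SaddlePt 2 gA) (b : Bool) (y : E2) : E2 :=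
  Q.QB.entBack (Q.σ s) (Q.coneU φ s b y)

/-- **The spatial transition map** between the Milnor charts of `s` and `σ s` through the cones. [folklore] -/
def piMap (φ : Metric.sphere (0 : E3) 1 ≃ₘ⟮𝓡 2, 𝓡 2⟯ Metric.sphere (0 : E3) 1) (s : SaddlePt 2 gA) : E3 → E3 :=
  (Q.QB.DA (Q.σ s)).coord ∘ C.B.coneParam ∘ sphereCone φ ∘ Q.QA.transition s

variable {Q} {s : SaddlePt 2 gA} (hkA : ∀ s, (Q.QA.DA s).k = 1) (hkB : ∀ s', (Q.QB.DA s').k = 1)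
  (h₀ : gB C.B.p₀ = gA C.A.p₀) (hc : Q.QB.c = Q.QA.c)
  {φ : Metric.sphere (0 : E3) 1 ≃ₘ⟮𝓡 2, 𝓡 2⟯ Metric.sphere (0 : E3) 1}
  (hφ0 : ∀ b, (φ (unitVec (Q.QA.coreDir s b)) : E3) = C.A.rad⁻¹ • Q.QB.coreDir (Q.σ s) b)

/-- Unfolding `coneU`. [folklore] -/
theorem coneU_def (b : Bool) (y : E2) : Q.coneU φ s b y = C.A.rad • (φ (unitVec (Q.QA.entDir s b y)) : E3) := rfl

/-- Unfolding `tPlanar`. [folklore] -/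
theorem tPlanar_def (b : Bool) (y : E2) : Q.tPlanar φ s b y = Q.QB.entBack (Q.σ s) (Q.coneU φ s b y) := rfl

/-- Unfolding `piMap`. [folklore] -/
theorem piMap_apply (u : E3) :
    Q.piMap φ s u = (Q.QB.DA (Q.σ s)).coord (C.B.coneParam (sphereCone φ (Q.QA.transition s u))) := rfl

/-- The direction `coneU` has norm `rad`. [folklore] -/
theorem norm_coneU (b : Bool) (y : E2) : ‖Q.coneU φ s b y‖ = C.A.rad := by
  rw [coneU_def, norm_smul, Real.norm_of_nonneg C.A.rad_pos.le, norm_eq_of_mem_sphere, mul_one]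

include hφ0 in
/-- **At the centre, `coneU 0` is the core direction of `σ s`.** [folklore] -/
theorem coneU_zero (b : Bool) : Q.coneU φ s b 0 = Q.QB.coreDir (Q.σ s) b := by
  rw [coneU_def, show Q.QA.entDir s b 0 = Q.QA.coreDir s b from rfl, hφ0, smul_smul, mul_inv_cancel₀ C.A.rad_pos.ne', one_smul]

include hkB hφ0 in
/-- **The planar transition fixes the centre: `tPlanar 0 = 0`.** [folklore] -/
theorem tb_zero (b : Bool) : Q.tPlanar φ s b 0 = 0 := by
  rw [tPlanar_def, Q.coneU_zero hφ0, show Q.QB.coreDir (Q.σ s) b = Q.QB.entDir (Q.σ s) b 0 from rfl]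
  exact Q.QB.entBack_entDir (hkB _) (by rw [norm_zero]; simpa using Q.QB.sq_pos)

/-- The entrance levels agree. [folklore] -/
theorem entLevel_eq (hc : Q.QB.c = Q.QA.c) : Q.QB.entLevel = Q.QA.entLevel := by
  rw [BasinPair.SaddleData.entLevel_def, BasinPair.SaddleData.entLevel_def, hc, Q.ε_eq]

include hkA in
/-- **The `A`-transition of an entrance point**: `transition_A s (entPoint ε b y) = (r₁ / rad) • entDir_A s b y`
with `r₁ = c - ε² - gA p₀`. [folklore] -/
theorem transition_entPoint {b : Bool} {y : E2} (hy : ‖y‖ ^ 2 < Q.QA.ε ^ 2) :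
    Q.QA.transition s (entPoint Q.QA.ε b y) = ((Q.QA.c - Q.QA.ε ^ 2 - gA C.A.p₀) / C.A.rad) • Q.QA.entDir s b y := by
  rw [BasinPair.SaddleData.transition_def, show (Q.QA.DA s).pt (entPoint Q.QA.ε b y) = Q.QA.entW s b y from rfl,
    BasinSetting.coneInv_def, Q.QA.apply_entW (hkA s) hy, BasinPair.SaddleData.entLevel_def]
  rfl

include hkA in
/-- **The cone of `φ` on the `A`-transition of an entrance point**: `(r₁ / rad) • coneU y`. [folklore] -/
theorem sphereCone_transition_entPoint {b : Bool} {y : E2} (hy : ‖y‖ ^ 2 < Q.QA.ε ^ 2) :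
    sphereCone φ (Q.QA.transition s (entPoint Q.QA.ε b y)) = ((Q.QA.c - Q.QA.ε ^ 2 - gA C.A.p₀) / C.A.rad) • Q.coneU φ s b y := by
  have hp₀ : gA C.A.p₀ < Q.QA.c - Q.QA.ε ^ 2 := Q.QA.apply_p₀_lt_c_sub_sq
  have hr : 0 < (Q.QA.c - Q.QA.ε ^ 2 - gA C.A.p₀) / C.A.rad := div_pos (by linarith) C.A.rad_pos
  have hne : Q.QA.entDir s b y ≠ 0 := by rw [← norm_ne_zero_iff, Q.QA.norm_entDir (hkA s) hy]; exact C.A.rad_pos.ne'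
  have hn : ‖Q.QA.entDir s b y‖ = C.A.rad := Q.QA.norm_entDir (hkA s) hy
  rw [Q.transition_entPoint hkA hy, sphereCone_def, norm_smul, Real.norm_of_nonneg hr.le, hn, coneU_def, smul_smul,
    div_mul_cancel₀ _ C.A.rad_pos.ne']
  congr 2
  rw [eq_norm_smul_unitVec hne, smul_smul, hn]
  rw [unitVec_smul_coe (mul_pos hr C.A.rad_pos), unitVec_smul_coe C.A.rad_pos]

include hkA h₀ hc in
/-- **`coneParam_B` of the cone image is the entrance point `entOf_B (coneU y)`.** [folklore] -/
theorem coneParam_sphereCone_transition_entPoint {b : Bool} {y : E2} (hy : ‖y‖ ^ 2 < Q.QA.ε ^ 2) :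
    C.B.coneParam (sphereCone φ (Q.QA.transition s (entPoint Q.QA.ε b y))) = Q.QB.entOf (Q.coneU φ s b y) := by
  have hp₀ : gA C.A.p₀ < Q.QA.c - Q.QA.ε ^ 2 := Q.QA.apply_p₀_lt_c_sub_sq
  have hr₁ : 0 < Q.QA.c - Q.QA.ε ^ 2 - gA C.A.p₀ := by linarith
  have hr : 0 < (Q.QA.c - Q.QA.ε ^ 2 - gA C.A.p₀) / C.A.rad := div_pos hr₁ C.A.rad_pos
  rw [Q.sphereCone_transition_entPoint hkA hy, BasinSetting.coneParam_def]
  have hnorm : ‖((Q.QA.c - Q.QA.ε ^ 2 - gA C.A.p₀) / C.A.rad) • Q.coneU φ s b y‖ = Q.QA.c - Q.QA.ε ^ 2 - gA C.A.p₀ := by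
    rw [norm_smul, Real.norm_of_nonneg hr.le, norm_coneU, div_mul_cancel₀ _ C.A.rad_pos.ne']
  have hsc : (C.B.rad / (Q.QA.c - Q.QA.ε ^ 2 - gA C.A.p₀)) • ((Q.QA.c - Q.QA.ε ^ 2 - gA C.A.p₀) / C.A.rad) • Q.coneU φ s b y =
      Q.coneU φ s b y := by
    rw [smul_smul, C.rad_eq]
    have h1 : C.A.rad / (Q.QA.c - Q.QA.ε ^ 2 - gA C.A.p₀) * ((Q.QA.c - Q.QA.ε ^ 2 - gA C.A.p₀) / C.A.rad) = 1 := by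
      rw [div_mul_div_comm, mul_comm (Q.QA.c - Q.QA.ε ^ 2 - gA C.A.p₀) C.A.rad, div_self (mul_ne_zero C.A.rad_pos.ne' hr₁.ne')]
    rw [h1, one_smul]
  have hlev : gB C.B.p₀ + (Q.QA.c - Q.QA.ε ^ 2 - gA C.A.p₀) = Q.QB.entLevel := by
    rw [Q.entLevel_eq hc, BasinPair.SaddleData.entLevel_def, h₀]; ring
  rw [hnorm, hsc, hlev]
  rfl

include hkA hkB h₀ hc in
/-- **The spatial transition on the entrance sheet is the planar transition**:
`piMap (entPoint ε b y) = entPoint ε b (tPlanar y)` whenever `‖y‖² < ε²` and `coneU y` lies in the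
inverse-chart domain of `σ s`. [cite: MilnorHCobordism1965, proof of Thm. 3.13] -/
theorem piMap_entPoint_of_mem {b : Bool} {y : E2} (hy : ‖y‖ ^ 2 < Q.QA.ε ^ 2)
    (hmem : Q.coneU φ s b y ∈ Q.QB.entDom (Q.σ s) b (Q.QB.ε ^ 2)) :
    Q.piMap φ s (entPoint Q.QA.ε b y) = entPoint Q.QA.ε b (Q.tPlanar φ s b y) := by
  rw [piMap_apply, Q.coneParam_sphereCone_transition_entPoint hkA h₀ hc hy]
  obtain ⟨he, hlt⟩ := Q.QB.entW_entBack (hkB _) le_rfl hmem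
  rw [← he, tPlanar_def]
  have h := (BasinPair.SaddleData.entW_mem_chartBall (Q := Q.QB) (s := Q.σ s) (b := b) hlt).2
  convert h using 2; exact Q.ε_eq.symm

/-! ### Smoothness and the germ identity near the centre -/

include hkA in
/-- **`coneU` is smooth** at `y` with `‖y‖² < ε²`. [folklore] -/
theorem contMDiffAt_coneU {b : Bool} {y : E2} (hy : ‖y‖ ^ 2 < Q.QA.ε ^ 2) :
    ContMDiffAt 𝓘(ℝ, E2) 𝓘(ℝ, E3) ∞ (Q.coneU φ s b) y := by
  have hne : Q.QA.entDir s b y ≠ 0 := by rw [← norm_ne_zero_iff, Q.QA.norm_entDir (hkA s) hy]; exact C.A.rad_pos.ne'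
  have h1 : ContMDiffAt 𝓘(ℝ, E2) 𝓘(ℝ, E3) ∞ (Q.QA.entDir s b) y := Q.QA.contMDiffAt_entDir (hkA s) hy
  have h2 : ContMDiffAt 𝓘(ℝ, E3) (𝓡 2) ∞ unitVec (Q.QA.entDir s b y) := (contMDiffOn_unitVec _ hne).contMDiffAt (isOpen_ne.mem_nhds hne)
  have h12 : ContMDiffAt 𝓘(ℝ, E2) (𝓡 2) ∞ (fun y : E2 => unitVec (Q.QA.entDir s b y)) y := h2.comp y h1
  have h4 : ContMDiff (𝓡 2) 𝓘(ℝ, E3) ∞ (fun v : Metric.sphere (0 : E3) 1 => ((φ v : Metric.sphere (0 : E3) 1) : E3)) :=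
    contMDiff_coe_sphere.comp φ.contMDiff
  have h5 : ContMDiffAt 𝓘(ℝ, E2) 𝓘(ℝ, E3) ∞ (fun y : E2 => ((φ (unitVec (Q.QA.entDir s b y)) : Metric.sphere (0 : E3) 1) : E3)) y :=
    (h4 _).comp y h12
  have h6 : ContDiffAt ℝ ∞ (fun y : E2 => C.A.rad • ((φ (unitVec (Q.QA.entDir s b y)) : Metric.sphere (0 : E3) 1) : E3)) y :=
    ContDiffAt.smul (f := fun _ : E2 => C.A.rad) (g := fun y : E2 => ((φ (unitVec (Q.QA.entDir s b y)) : Metric.sphere (0 : E3) 1) : E3))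
      contDiffAt_const h5.contDiffAt
  exact h6.contMDiffAt

include hkA in
/-- `coneU` is continuous at such `y`. [folklore] -/
theorem continuousAt_coneU {b : Bool} {y : E2} (hy : ‖y‖ ^ 2 < Q.QA.ε ^ 2) : ContinuousAt (Q.coneU φ s b) y :=
  (Q.contMDiffAt_coneU hkA hy).continuousAt

include hkA hkB hφ0 in
/-- **Near the centre, `coneU y` lies in the inverse-chart domain of `σ s`.** [folklore] -/
theorem eventually_coneU_mem_entDom (b : Bool) :
    ∀ᶠ y in 𝓝 (0 : E2), ‖y‖ ^ 2 < Q.QA.ε ^ 2 ∧ Q.coneU φ s b y ∈ Q.QB.entDom (Q.σ s) b (Q.QB.ε ^ 2) := by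
  have h0 : ‖(0 : E2)‖ ^ 2 < Q.QA.ε ^ 2 := by rw [norm_zero]; simpa using Q.QA.sq_pos
  have h1 : ∀ᶠ y in 𝓝 (0 : E2), ‖y‖ ^ 2 < Q.QA.ε ^ 2 :=
    (isOpen_lt (continuous_norm.pow 2) continuous_const).mem_nhds h0
  have hmem0 : Q.coneU φ s b 0 ∈ Q.QB.entDom (Q.σ s) b (Q.QB.ε ^ 2) := by
    rw [Q.coneU_zero hφ0, show Q.QB.coreDir (Q.σ s) b = Q.QB.entDir (Q.σ s) b 0 from rfl]
    exact Q.QB.entDir_mem_entDom (hkB _) le_rfl (by rw [norm_zero]; simpa using Q.QB.sq_pos)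
  have h2 : ∀ᶠ y in 𝓝 (0 : E2), Q.coneU φ s b y ∈ Q.QB.entDom (Q.σ s) b (Q.QB.ε ^ 2) :=
    (Q.continuousAt_coneU hkA h0).preimage_mem_nhds ((Q.QB.isOpen_entDom _).mem_nhds hmem0)
  filter_upwards [h1, h2] with y hy1 hy2
  exact ⟨hy1, hy2⟩

include hkA hkB h₀ hc hφ0 in
/-- **Germ identity**: `piMap ∘ entPoint ε b = entPoint ε b ∘ tPlanar` near `0`. [cite: MilnorHCobordism1965, proof of Thm. 3.13] -/
theorem piMap_entPoint_eventuallyEq (b : Bool) :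
    (Q.piMap φ s ∘ entPoint Q.QA.ε b) =ᶠ[𝓝 (0 : E2)] (entPoint Q.QA.ε b ∘ Q.tPlanar φ s b) := by
  filter_upwards [Q.eventually_coneU_mem_entDom hkA hkB hφ0 b] with y hy
  exact Q.piMap_entPoint_of_mem hkA hkB h₀ hc hy.1 hy.2

include hkA in
/-- **The planar transition is smooth** where `coneU` lies in the inverse-chart domain. [folklore] -/
theorem contMDiffAt_tPlanar (b : Bool) {y : E2} (hy : ‖y‖ ^ 2 < Q.QA.ε ^ 2) (hmem : Q.coneU φ s b y ∈ Q.QB.entDom (Q.σ s) b (Q.QB.ε ^ 2)) :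
    ContMDiffAt 𝓘(ℝ, E2) 𝓘(ℝ, E2) ∞ (Q.tPlanar φ s b) y :=
  (Q.QB.contMDiffAt_entBack hmem).comp y (Q.contMDiffAt_coneU hkA hy)

end BasinCouple.SaddleData

end Literature.Topology.FourManifolds
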